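import Literature.Geometry.Lorentzian.KerrConvergence
import Literature.Geometry.Lorentzian.BilinPullbackEstimates
import Literature.Geometry.Lorentzian.SpacetimeMetricInCoordsCalculus
import Literature.Geometry.Lorentzian.BackgroundChartCalculus
import Literature.Geometry.Lorentzian.BoostedKerrSchildDecay
import Literature.Geometry.Lorentzian.MultiCentreRadiationZone
import Literature.Geometry.Lorentzian.MultiCentreKerrSchild
import Literature.Uncategorized.BilinPullbackNearIdConst
import Literature.Geometry.Lorentzian.BoundedGeometry
import HarnessLib

/-!
# Gluing toolbox for the gap certificate, I: the deviation of a re-gauged hole chart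
# (crux `StarvedNecks.NeckGapDecay`, stmt-FinalStateConjecture-16768, line `Sketch`, packaging stub P-glue `stub_certOfCoreFrom`)

For a chart `Ψ : B.domain → 𝓢` of a boosted Kerr background `B = boostedKerr(Λ, c, M, a)` and a smooth
self-map `S = id + P` of `E4`, the coordinate components of the re-gauged parametrisation
`Ψ ∘ ι⁻¹ ∘ S` (`ι⁻¹ = (chartAt E4 x₀).symm`, the inverse of the inclusion chart of the open domain) minus the
model metric split, on the open set `{z | S z ∈ B.domain}`, as

`S^*(Ψ^*g − g_B) + (S^*η − η) + S^*(g_B − η) − (g_B − η)`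

(`metricInCoords_regauge_sub_eq`), where `S^*` is the coordinate pull-back `bilinPullback S`
(`BilinPullbackEstimates`).  The three pull-back terms are then estimated pointwise in `C²`: the first and
third by the LINEAR `Cᵏ` estimate `norm_iteratedFDeriv_bilinPullback_le` (constant `4²·2!·2⁴ = 512` for a
`C³`-bound `2` on `S`), the second is the constant-coefficient near-identity estimate (stub W2,
`Literature.Uncategorized.BilinPullbackNearIdConst`, used by the assembly, not here), the last is the boosted
Kerr–Schild perturbation itself.  Also: `supCkENorm` over a union, eventual pointwise bounds from
`supCkENorm → 0`, and germ invariance of `Spacetime.deviation(Extend)`.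

References: O'Neill 1983, Ch. 3, Def. 3.9 (pull-back of tensors); DHRT arXiv:2104.08222, §1 (deviation
norms); Petersen 2006, Ch. 10, §3.2 (`Cᵏ` convergence is chart independent).  No new definitions.
-/

noncomputable section

open scoped Manifold ContDiff Topology ENNReal Nat
open Filter Set Function Topology Literature.Geometry.Lorentzian

namespace Summit.FinalStateConjecture.FinalStateConjecture.Theorems.NeckGapDecay.ConnectionLevelCones.Glue

set_option linter.dupNamespace false
-- instance search through nested operator types `E4 →L[ℝ] E4 →L[ℝ] ℝ`
set_option maxSynthPendingDepth 3

/-! ## `supCkENorm` bookkeeping -/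

section SupNorm

variable {F G : Type*} [NormedAddCommGroup F] [NormedSpace ℝ F] [NormedAddCommGroup G] [NormedSpace ℝ G]

/-- The `Cᵏ` sup norm over a union of two sets is at most the sum of the two sup norms. [folklore] -/
theorem supCkENorm_union_le (A A' : Set F) (k : ℕ) (f : F → G) :
    supCkENorm (A ∪ A') k f ≤ supCkENorm A k f + supCkENorm A' k f := by
  refine supCkENorm_le_of_forall_le fun m hm x hx ↦ ?_
  rcases hx with hx | hx
  · exact (enorm_iteratedFDeriv_le_supCkENorm hm hx f).trans le_self_add
  · exact (enorm_iteratedFDeriv_le_supCkENorm hm hx f).trans le_add_self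

/-- **Eventual pointwise bounds from `supCkENorm → 0`**: if the `Cᵏ` sup norms of `f` over the sets `S τ`
tend to `0`, then for every `ε > 0`, eventually in `τ`, all derivatives of order `≤ k` of `f` are `≤ ε` in
norm at every point of `S τ`. [folklore] -/
theorem exists_forall_norm_iteratedFDeriv_le_of_tendsto {S : ℝ → Set F} {k : ℕ} {f : F → G}
    (h : Tendsto (fun τ ↦ supCkENorm (S τ) k f) atTop (𝓝 0)) {ε : ℝ} (hε : 0 < ε) :
    ∃ τε : ℝ, ∀ τ, τε ≤ τ → ∀ x ∈ S τ, ∀ m, m ≤ k → ‖iteratedFDeriv ℝ m f x‖ ≤ ε := by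
  have hev := (ENNReal.tendsto_nhds_zero.1 h) (ENNReal.ofReal ε) (ENNReal.ofReal_pos.2 hε)
  obtain ⟨τε, hτε⟩ := eventually_atTop.1 hev
  refine ⟨τε, fun τ hτ x hx m hm ↦ ?_⟩
  have h1 := (enorm_iteratedFDeriv_le_supCkENorm hm hx f).trans (hτε τ hτ)
  rwa [← ofReal_norm, ENNReal.ofReal_le_ofReal_iff hε.le] at h1

end SupNorm

/-! ## Germ invariance of the deviation -/

section Germ

variable (𝓢 : Spacetime.{0} 4) (B : ModelBackground)

/-- The deviation at `x` depends only on the germ of the chart map at `x`. [folklore] -/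
theorem deviation_congr_of_eventuallyEq {Ψ₁ Ψ₂ : B.domain → 𝓢.carrier} {x : B.domain}
    (h : Ψ₁ =ᶠ[𝓝 x] Ψ₂) : 𝓢.deviation B Ψ₁ x = 𝓢.deviation B Ψ₂ x := by
  ext v w
  rw [Spacetime.deviation_apply, Spacetime.deviation_apply, h.mfderiv_eq, h.eq_of_nhds]

/-- Charts with the same germ at `x` have extended deviations with the same germ at `↑x` (the domain is
open in `E4`). [folklore] -/
theorem deviationExtend_eventuallyEq_of_eventuallyEq {Ψ₁ Ψ₂ : B.domain → 𝓢.carrier} {x : B.domain}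
    (h : Ψ₁ =ᶠ[𝓝 x] Ψ₂) : 𝓢.deviationExtend B Ψ₁ =ᶠ[𝓝 (x : E4)] 𝓢.deviationExtend B Ψ₂ := by
  have hopen : IsOpenEmbedding (Subtype.val : B.domain → E4) := B.domain.2.isOpenEmbedding_subtypeVal
  have h2 : ∀ᶠ y in 𝓝 x, 𝓢.deviationExtend B Ψ₁ y.1 = 𝓢.deviationExtend B Ψ₂ y.1 := by
    filter_upwards [h.eventually_nhds] with y hy
    rw [Spacetime.deviationExtend_coe, Spacetime.deviationExtend_coe, deviation_congr_of_eventuallyEq 𝓢 B hy]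
  rw [← hopen.map_nhds_eq x, Filter.EventuallyEq, eventually_map]
  exact h2

end Germ

/-! ## The algebra of coordinate pull-backs -/

section PullbackAlgebra

variable {E F : Type*} [NormedAddCommGroup E] [NormedSpace ℝ E] [NormedAddCommGroup F] [NormedSpace ℝ F]

/-- The coordinate pull-back is additive in the field. [folklore] -/
theorem bilinPullback_add_apply (θ : E → F) (B₁ B₂ : F → F →L[ℝ] F →L[ℝ] ℝ) (y : E) :
    bilinPullback θ (B₁ + B₂) y = bilinPullback θ B₁ y + bilinPullback θ B₂ y := by
  ext v w
  simp [bilinPullback_apply]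

/-- The coordinate pull-back at `y` sees the field only at `θ y`. [folklore] -/
theorem bilinPullback_congr_field {θ : E → F} {B₁ B₂ : F → F →L[ℝ] F →L[ℝ] ℝ} {y : E}
    (h : B₁ (θ y) = B₂ (θ y)) : bilinPullback θ B₁ y = bilinPullback θ B₂ y := by
  ext v w
  rw [bilinPullback_apply, bilinPullback_apply, h]

end PullbackAlgebra

/-! ## The re-gauged chart: its components minus the model metric -/

section Regauge

variable (𝓢 : Spacetime.{0} 4) (Λ : lorentzGroup) (c : E4) (M a : ℝ)

/-- The boosted Kerr–Schild perturbation `g_B − η` as a function on `E4`. [folklore] -/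
abbrev ksPert : E4 → E4 →L[ℝ] E4 →L[ℝ] ℝ := fun y ↦ boostedKerrBilin Λ c M a y - Minkowski.bilin

/-- **Splitting of the re-gauged deviation.**  For a chart `Ψ` of `B = boostedKerr(Λ,c,M,a)` smooth on the
domain and a self-map `S = id + P` of `E4` differentiable at `z` with `S z ∈ B.domain`, the components of the
re-gauged parametrisation `Ψ ∘ ι⁻¹ ∘ S` minus the model metric split at `z` into
`S^*(Ψ^*g − g_B) + (S^*η − η) + (S^*(g_B − η) − (g_B − η))`. [folklore] -/
theorem metricInCoords_regauge_sub_eq (𝓢 : Spacetime.{0} 4) (Λ : lorentzGroup) (c : E4) (M a : ℝ)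
    (Ψ : (boostedKerrBackground Λ c M a).domain → 𝓢.carrier)
    (hΨ : ContMDiff 𝓘(ℝ, E4) (𝓡 4) ∞ Ψ) (x₀ : (boostedKerrBackground Λ c M a).domain) (P : E4 → E4)
    {z : E4} (hP : DifferentiableAt ℝ P z) (hz : z + P z ∈ (boostedKerrBackground Λ c M a).domain) :
    𝓢.metricInCoords (Ψ ∘ (chartAt E4 x₀).symm ∘ fun w ↦ w + P w) z - boostedKerrBilin Λ c M a z =
      bilinPullback (fun w ↦ w + P w)
          (𝓢.deviationExtend (boostedKerrBackground Λ c M a) Ψ) z +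
        (bilinPullback (fun w ↦ w + P w) (fun _ ↦ Minkowski.bilin) z - Minkowski.bilin) +
        (bilinPullback (fun w ↦ w + P w) (ksPert Λ c M a) z - ksPert Λ c M a z) := by
  -- the parametrisation is differentiable at `S z ∈ B.domain`
  have hΨ' : MDifferentiableAt 𝓘(ℝ, E4) (𝓡 4) (Ψ ∘ (chartAt E4 x₀).symm) (z + P z) :=
    𝓢.mdifferentiableAt_comp_chartAt_symm (boostedKerrBackground Λ c M a) Ψ x₀ hz
      ((hΨ ⟨z + P z, hz⟩).mdifferentiableAt (by simp))
  have hSd : DifferentiableAt ℝ (fun w ↦ w + P w) z := differentiableAt_id.add hP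
  -- chain rule
  have h1 : 𝓢.metricInCoords (Ψ ∘ (chartAt E4 x₀).symm ∘ fun w ↦ w + P w) z =
      bilinPullback (fun w ↦ w + P w) (𝓢.metricInCoords (Ψ ∘ (chartAt E4 x₀).symm)) z :=
    𝓢.metricInCoords_comp (ψ := Ψ ∘ (chartAt E4 x₀).symm) (θ := fun w ↦ w + P w) hΨ' hSd
  -- components of `Ψ` at `S z` = deviation + model
  have h2 : 𝓢.metricInCoords (Ψ ∘ (chartAt E4 x₀).symm) (z + P z) =
      𝓢.deviationExtend (boostedKerrBackground Λ c M a) Ψ (z + P z) +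
        (boostedKerrBackground Λ c M a).bilin (z + P z) :=
    𝓢.metricInCoords_comp_chartAt_symm_eq_deviationExtend_add (boostedKerrBackground Λ c M a) Ψ x₀ hz
      ((hΨ ⟨z + P z, hz⟩).mdifferentiableAt (by simp))
  have h3 : bilinPullback (fun w ↦ w + P w) (𝓢.metricInCoords (Ψ ∘ (chartAt E4 x₀).symm)) z =
      bilinPullback (fun w ↦ w + P w) (𝓢.deviationExtend (boostedKerrBackground Λ c M a) Ψ +
        (boostedKerrBackground Λ c M a).bilin) z :=
    bilinPullback_congr_field (by rw [h2]; rfl)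
  have h4 : (boostedKerrBackground Λ c M a).bilin = (fun _ ↦ Minkowski.bilin) + ksPert Λ c M a := by
    funext y
    show boostedKerrBilin Λ c M a y = Minkowski.bilin + (boostedKerrBilin Λ c M a y - Minkowski.bilin)
    abel
  have h5 : boostedKerrBilin Λ c M a z = Minkowski.bilin + ksPert Λ c M a z := by
    show boostedKerrBilin Λ c M a z = Minkowski.bilin + (boostedKerrBilin Λ c M a z - Minkowski.bilin)
    abel
  rw [h1, h3, bilinPullback_add_apply, h4, bilinPullback_add_apply, h5]
  abel

end Regauge

/-! ## Pointwise `C²` bounds for pull-backs along a `C³`-controlled near-identity map -/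

section NearIdBounds

variable {V : Type*} [NormedAddCommGroup V] [NormedSpace ℝ V]

/-- Derivatives of `S = id + P`: `‖Dⁱ S(z)‖ ≤ 1 + ‖Dⁱ P(z)‖` for `i ≥ 1` (`D id = id` has norm `≤ 1`, the higher
derivatives of the identity vanish). [folklore] -/
theorem norm_iteratedFDeriv_id_add_le {P : E4 → E4} {n : ℕ∞} (hP : ContDiff ℝ n P) {i : ℕ} (hi1 : 1 ≤ i)
    (hin : (i : ℕ∞) ≤ n) (z : E4) :
    ‖iteratedFDeriv ℝ i (fun w ↦ w + P w) z‖ ≤ 1 + ‖iteratedFDeriv ℝ i P z‖ := by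
  have hid : ContDiffAt ℝ i (fun w : E4 ↦ w) z := contDiffAt_id
  have hPi : ContDiffAt ℝ i P z := (hP.of_le (by exact_mod_cast hin)).contDiffAt
  have hsum : iteratedFDeriv ℝ i (fun w ↦ w + P w) z =
      iteratedFDeriv ℝ i (fun w : E4 ↦ w) z + iteratedFDeriv ℝ i P z :=
    iteratedFDeriv_add_apply (f := fun w : E4 ↦ w) (g := P) hid hPi
  rw [hsum]
  refine (norm_add_le _ _).trans (add_le_add ?_ le_rfl)
  -- `‖Dⁱ id‖ ≤ 1`
  obtain ⟨j, rfl⟩ : ∃ j, i = j + 1 := ⟨i - 1, by omega⟩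
  rw [← norm_iteratedFDeriv_fderiv]
  have hfd : fderiv ℝ (fun w : E4 ↦ w) = fun _ ↦ ContinuousLinearMap.id ℝ E4 := by
    funext y; exact fderiv_id
  rw [hfd]
  rcases j with _ | j
  · rw [norm_iteratedFDeriv_zero]
    exact ContinuousLinearMap.norm_id_le
  · rw [iteratedFDeriv_succ_const]
    simp

/-- **Linear pull-back estimate along a near-identity map.**  If `S = id + P` with `P` of class `C³` and
`‖Dʲ P(z)‖ ≤ 1` (`j = 1,2,3`), `S z ∈ t` (`t` open), and the field `Φ` is `C²` on `t` with `‖Dʲ Φ(S z)‖ ≤ N`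
(`j ≤ 2`), then `‖Dᵐ (S^*Φ)(z)‖ ≤ 512 N` for `m ≤ 2` (`norm_iteratedFDeriv_bilinPullback_le` with `k = 2`,
`Θ = 2`: `4²·2!·2⁴ = 512`). [folklore] -/
theorem norm_iteratedFDeriv_bilinPullback_id_add_le {t : Set E4} (ht : IsOpen t)
    {Φ : E4 → E4 →L[ℝ] E4 →L[ℝ] ℝ} (hΦ : ContDiffOn ℝ 2 Φ t) {P : E4 → E4} (hP : ContDiff ℝ 3 P) {z : E4}
    (hz : z + P z ∈ t) (hPb : ∀ j, 1 ≤ j → j ≤ 3 → ‖iteratedFDeriv ℝ j P z‖ ≤ 1) {N : ℝ} (hN : 0 ≤ N)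
    (hNb : ∀ j, j ≤ 2 → ‖iteratedFDeriv ℝ j Φ (z + P z)‖ ≤ N) {m : ℕ} (hm : m ≤ 2) :
    ‖iteratedFDeriv ℝ m (bilinPullback (fun w ↦ w + P w) Φ) z‖ ≤ 512 * N := by
  set s : Set E4 := (fun w ↦ w + P w) ⁻¹' t with hs
  have hSc : ContDiff ℝ 3 (fun w ↦ w + P w) := contDiff_id.add hP
  have hso : IsOpen s := ht.preimage hSc.continuous
  have hzs : z ∈ s := hz
  have key := norm_iteratedFDeriv_bilinPullback_le (θ := fun w ↦ w + P w) (B := Φ) (k := 2) hso ht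
    (hSc.contDiffOn (s := s)) hΦ (fun w hw ↦ hw) hzs (Θ := 2) (N := N) (by norm_num) hN
    (fun i h1 hi ↦ ?_) hNb hm
  · refine key.trans (le_of_eq ?_)
    norm_num
  · have h := norm_iteratedFDeriv_id_add_le (n := 3) hP h1 (by exact_mod_cast hi) z
    have h' := hPb i h1 hi
    linarith

end NearIdBounds

/-! ## Decay of the boosted Kerr–Schild perturbation at large rest radius, in `ε`-form -/

section KsDecay

variable (Λ : lorentzGroup) (c : E4) (M a : ℝ)

/-- All derivatives of order `≤ 2` of the boosted Kerr–Schild perturbation `g_B − η` are eventually (in the rest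
radius) smaller than any `ε > 0` (`norm_iteratedFDeriv_boostedKsPert_le`: `‖Dᵐ(g_B − η)‖ ≤ Cₘ / r` beyond
`r ≥ Rₘ`). [folklore] -/
theorem exists_radius_forall_norm_iteratedFDeriv_ksPert_le {ε : ℝ} (hε : 0 < ε) :
    ∃ R : ℝ, 0 < R ∧ ∀ x : E4, R ≤ Kerr.radius a (poincareInv Λ c x) →
      ∀ m, m ≤ 2 → ‖iteratedFDeriv ℝ m (ksPert Λ c M a) x‖ ≤ ε := by
  obtain ⟨C₀, R₀, hR₀, h₀⟩ := norm_iteratedFDeriv_boostedKsPert_le Λ c M a 0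
  obtain ⟨C₁, R₁, hR₁, h₁⟩ := norm_iteratedFDeriv_boostedKsPert_le Λ c M a 1
  obtain ⟨C₂, R₂, hR₂, h₂⟩ := norm_iteratedFDeriv_boostedKsPert_le Λ c M a 2
  set C : ℝ := max (max C₀ C₁) (max C₂ 0) with hC
  have hC0 : 0 ≤ C := le_max_of_le_right (le_max_right _ _)
  refine ⟨max (max R₀ R₁) (max R₂ (C / ε + 1)), lt_max_of_lt_left (lt_max_of_lt_left hR₀), fun x hx m hm ↦ ?_⟩
  set r := Kerr.radius a (poincareInv Λ c x) with hr
  have hr0 : 0 < r := hR₀.trans_le ((le_max_left _ _).trans ((le_max_left _ _).trans hx))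
  have hCr : C / r ≤ ε := by
    have h1 : C / ε + 1 ≤ r := (le_max_right _ _).trans ((le_max_right _ _).trans hx)
    rw [div_le_iff₀ hr0]
    have h2 : C / ε * ε = C := div_mul_cancel₀ C hε.ne'
    nlinarith
  have hbound : ∀ {C' : ℝ}, C' ≤ C → C' / r ≤ ε := fun {C'} hC' ↦
    (div_le_div_of_nonneg_right hC' hr0.le).trans hCr
  interval_cases m
  · exact (h₀ x ((le_max_left _ _).trans ((le_max_left _ _).trans hx))).trans
      (hbound ((le_max_left _ _).trans (le_max_left _ _)))
  · exact (h₁ x ((le_max_right _ _).trans ((le_max_left _ _).trans hx))).trans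
      (hbound ((le_max_right _ _).trans (le_max_left _ _)))
  · exact (h₂ x ((le_max_left _ _).trans ((le_max_right _ _).trans hx))).trans
      (hbound ((le_max_left _ _).trans (le_max_right _ _)))

/-- The perturbation is smooth where the rest radius is positive. [folklore] -/
theorem contDiffOn_ksPert :
    ContDiffOn ℝ ∞ (ksPert Λ c M a) {x : E4 | 0 < Kerr.radius a (poincareInv Λ c x)} :=
  fun _ hx ↦ (contDiffAt_boostedKsPert (Λ := Λ) hx).contDiffWithinAt

/-- The set of positive rest radius is open. [folklore] -/
theorem isOpen_setOf_radius_pos : IsOpen {x : E4 | 0 < Kerr.radius a (poincareInv Λ c x)} :=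
  isOpen_lt continuous_const ((Kerr.continuous_radius a).comp (continuous_poincareInv Λ c))

end KsDecay

/-! ## The zone-2 estimate: `C²` size of the re-gauged deviation at a point of the seam shell -/

section Zone2

variable (𝓢 : Spacetime.{0} 4) (Λ : lorentzGroup) (c : E4) (M a : ℝ)

/-- Points of the boosted exterior have positive rest radius. [folklore] -/
theorem radius_pos_of_mem_domain {y : E4} (hy : y ∈ ((boostedKerrBackground Λ c M a).domain : Set E4)) :
    0 < Kerr.radius a (poincareInv Λ c y) := by
  have h : poincareInv Λ c y ∈ Kerr.exterior M a := hy
  rw [Kerr.mem_exterior] at h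
  exact (le_max_right _ _).trans_lt h

/-- The extended deviation of a smooth chart of the boosted background is `C^∞` on the domain. [folklore] -/
theorem contDiffOn_deviationExtend (Ψ : (boostedKerrBackground Λ c M a).domain → 𝓢.carrier)
    (hΨ : ContMDiff 𝓘(ℝ, E4) (𝓡 4) ∞ Ψ) {n : ℕ∞} :
    ContDiffOn ℝ n (𝓢.deviationExtend (boostedKerrBackground Λ c M a) Ψ)
      ((boostedKerrBackground Λ c M a).domain : Set E4) := fun y hy ↦
  ((𝓢.contDiffAt_deviationExtend_model (boostedKerrBackground Λ c M a) hΨ ⟨y, hy⟩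
    (contDiffAt_boostedKerrBilin Λ c M a (radius_pos_of_mem_domain Λ c M a hy))).of_le
      (by exact_mod_cast le_top)).contDiffWithinAt

/-- **Zone-2 estimate.**  Let `Ψ` be a smooth chart of `B = boostedKerr(Λ,c,M,a)`, `S = id + P` with `P` smooth,
`z ∈ B.domain` with `S z ∈ B.domain`, `‖DʲP(z)‖ ≤ ε ≤ 1` (`j = 1,2,3`), `‖Dʲ(Ψ^*g − g_B)(S z)‖ ≤ N₁` and
`‖Dʲ(g_B − η)‖ ≤ N₃` at `S z` and at `z` (`j ≤ 2`).  Then the components of the re-gauged parametrisation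
`Ψ ∘ ι⁻¹ ∘ S` deviate from the model at `z` by at most `512 N₁ + 8 ε + 513 N₃` in `C²` (splitting
`metricInCoords_regauge_sub_eq`; linear pull-back estimates; stub W2 `BilinPullbackNearIdConst` for the constant
part, `‖η‖ ≤ 1`). [folklore] -/
theorem norm_iteratedFDeriv_regauge_sub_le (hW2 : Literature.Uncategorized.BilinPullbackNearIdConst)
    (Ψ : (boostedKerrBackground Λ c M a).domain → 𝓢.carrier) (hΨ : ContMDiff 𝓘(ℝ, E4) (𝓡 4) ∞ Ψ)
    (x₀ : (boostedKerrBackground Λ c M a).domain) {P : E4 → E4} (hP : ContDiff ℝ ∞ P) {z : E4}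
    (hz : z ∈ ((boostedKerrBackground Λ c M a).domain : Set E4))
    (hSz : z + P z ∈ ((boostedKerrBackground Λ c M a).domain : Set E4))
    {ε : ℝ} (hε0 : 0 ≤ ε) (hε1 : ε ≤ 1) (hPb : ∀ j, 1 ≤ j → j ≤ 3 → ‖iteratedFDeriv ℝ j P z‖ ≤ ε)
    {N₁ : ℝ} (hN₁ : 0 ≤ N₁)
    (hN₁b : ∀ j, j ≤ 2 →
      ‖iteratedFDeriv ℝ j (𝓢.deviationExtend (boostedKerrBackground Λ c M a) Ψ) (z + P z)‖ ≤ N₁)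
    {N₃ : ℝ} (hN₃ : 0 ≤ N₃) (hN₃b : ∀ j, j ≤ 2 → ‖iteratedFDeriv ℝ j (ksPert Λ c M a) (z + P z)‖ ≤ N₃)
    (hN₄b : ∀ j, j ≤ 2 → ‖iteratedFDeriv ℝ j (ksPert Λ c M a) z‖ ≤ N₃) {m : ℕ} (hm : m ≤ 2) :
    ‖iteratedFDeriv ℝ m (fun w ↦ 𝓢.metricInCoords (Ψ ∘ (chartAt E4 x₀).symm ∘ fun w ↦ w + P w) w -
        boostedKerrBilin Λ c M a w) z‖ ≤ 512 * N₁ + 8 * ε + 513 * N₃ := by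
  have hdomo : IsOpen ((boostedKerrBackground Λ c M a).domain : Set E4) := (boostedKerrBackground Λ c M a).domain.2
  -- the players
  set F₁ : E4 → E4 →L[ℝ] E4 →L[ℝ] ℝ := bilinPullback (fun w ↦ w + P w) (𝓢.deviationExtend (boostedKerrBackground Λ c M a) Ψ) with hF₁
  set F₂ : E4 → E4 →L[ℝ] E4 →L[ℝ] ℝ :=
    fun y ↦ bilinPullback (fun w ↦ w + P w) (fun _ ↦ Minkowski.bilin) y - Minkowski.bilin with hF₂
  set F₃ : E4 → E4 →L[ℝ] E4 →L[ℝ] ℝ := bilinPullback (fun w ↦ w + P w) (ksPert Λ c M a) with hF₃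
  set F₄ : E4 → E4 →L[ℝ] E4 →L[ℝ] ℝ := ksPert Λ c M a with hF₄
  -- the open set where `S` lands in the domain
  set U₁ : Set E4 := (fun w ↦ w + P w) ⁻¹' ((boostedKerrBackground Λ c M a).domain : Set E4) with hU₁
  have hSc : ContDiff ℝ ∞ (fun w ↦ w + P w) := contDiff_id.add hP
  have hU₁o : IsOpen U₁ := hdomo.preimage hSc.continuous
  have hzU₁ : z ∈ U₁ := hSz
  -- identity on `U₁`
  have hident : (fun w ↦ 𝓢.metricInCoords (Ψ ∘ (chartAt E4 x₀).symm ∘ fun w ↦ w + P w) w -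
      boostedKerrBilin Λ c M a w) =ᶠ[𝓝 z] fun w ↦ F₁ w + F₂ w + (F₃ w - F₄ w) := by
    filter_upwards [hU₁o.mem_nhds hzU₁] with w hw
    rw [metricInCoords_regauge_sub_eq 𝓢 Λ c M a Ψ hΨ x₀ P (hP.differentiable (by simp)).differentiableAt hw]
  rw [(hident.iteratedFDeriv ℝ m).eq_of_nhds]
  -- smoothness of the players at `z`
  have hmtop : (m : ℕ∞) + 1 ≤ ⊤ := le_top
  have hSm : ContDiffOn ℝ ((m : ℕ∞) + 1) (fun w ↦ w + P w) U₁ := (hSc.of_le (by exact_mod_cast hmtop)).contDiffOn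
  have hdev : ContDiffOn ℝ (m : ℕ∞) (𝓢.deviationExtend (boostedKerrBackground Λ c M a) Ψ)
      ((boostedKerrBackground Λ c M a).domain : Set E4) := contDiffOn_deviationExtend 𝓢 Λ c M a Ψ hΨ
  have hF₁s : ContDiffOn ℝ (m : ℕ∞) F₁ U₁ := hSm.bilinPullback hdev hU₁o fun w hw ↦ hw
  have hconst : ContDiffOn ℝ (m : ℕ∞) (fun _ : E4 ↦ (Minkowski.bilin : E4 →L[ℝ] E4 →L[ℝ] ℝ)) univ :=
    contDiffOn_const
  have hF₂s : ContDiffOn ℝ (m : ℕ∞) F₂ U₁ :=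
    (hSm.bilinPullback hconst hU₁o fun _ _ ↦ mem_univ _).sub contDiffOn_const
  have hks : ContDiffOn ℝ (m : ℕ∞) (ksPert Λ c M a) {x : E4 | 0 < Kerr.radius a (poincareInv Λ c x)} :=
    (contDiffOn_ksPert Λ c M a).of_le (by exact_mod_cast le_top)
  have hF₃s : ContDiffOn ℝ (m : ℕ∞) F₃ U₁ :=
    hSm.bilinPullback hks hU₁o fun w hw ↦ radius_pos_of_mem_domain Λ c M a hw
  have hF₄a : ContDiffAt ℝ (m : ℕ∞) F₄ z :=
    (contDiffAt_boostedKsPert (Λ := Λ) (radius_pos_of_mem_domain Λ c M a hz)).of_le (by exact_mod_cast le_top)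
  have hF₁a : ContDiffAt ℝ (m : ℕ∞) F₁ z := (hF₁s z hzU₁).contDiffAt (hU₁o.mem_nhds hzU₁)
  have hF₂a : ContDiffAt ℝ (m : ℕ∞) F₂ z := (hF₂s z hzU₁).contDiffAt (hU₁o.mem_nhds hzU₁)
  have hF₃a : ContDiffAt ℝ (m : ℕ∞) F₃ z := (hF₃s z hzU₁).contDiffAt (hU₁o.mem_nhds hzU₁)
  -- split the derivative of the sum
  have hsplit : iteratedFDeriv ℝ m (fun w ↦ F₁ w + F₂ w + (F₃ w - F₄ w)) z =
      iteratedFDeriv ℝ m F₁ z + iteratedFDeriv ℝ m F₂ z + (iteratedFDeriv ℝ m F₃ z - iteratedFDeriv ℝ m F₄ z) := by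
    have h34 : iteratedFDeriv ℝ m (fun w ↦ F₃ w - F₄ w) z = iteratedFDeriv ℝ m F₃ z - iteratedFDeriv ℝ m F₄ z :=
      iteratedFDeriv_sub_apply hF₃a hF₄a
    have h12 : iteratedFDeriv ℝ m (fun w ↦ F₁ w + F₂ w) z = iteratedFDeriv ℝ m F₁ z + iteratedFDeriv ℝ m F₂ z :=
      iteratedFDeriv_add_apply hF₁a hF₂a
    have h := iteratedFDeriv_add_apply (f := fun w ↦ F₁ w + F₂ w) (g := fun w ↦ F₃ w - F₄ w)
      (hF₁a.add hF₂a) (hF₃a.sub hF₄a) (i := m)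
    rw [h12, h34] at h
    exact h
  rw [hsplit]
  -- the four bounds
  have hPb' : ∀ j, 1 ≤ j → j ≤ 3 → ‖iteratedFDeriv ℝ j P z‖ ≤ 1 := fun j h1 hj ↦ (hPb j h1 hj).trans hε1
  have hP3 : ContDiff ℝ 3 P := contDiff_infty.1 hP 3
  have hdev2 : ContDiffOn ℝ 2 (𝓢.deviationExtend (boostedKerrBackground Λ c M a) Ψ)
      ((boostedKerrBackground Λ c M a).domain : Set E4) := contDiffOn_deviationExtend 𝓢 Λ c M a Ψ hΨ
  have h1 : ‖iteratedFDeriv ℝ m F₁ z‖ ≤ 512 * N₁ :=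
    norm_iteratedFDeriv_bilinPullback_id_add_le hdomo hdev2 hP3 hSz hPb' hN₁ hN₁b hm
  have h2 : ‖iteratedFDeriv ℝ m F₂ z‖ ≤ 8 * ε := by
    have h := hW2 Minkowski.bilin P univ z ε isOpen_univ (mem_univ _) hP3.contDiffOn hε0 hε1 hPb m hm
    have hη : ‖(Minkowski.bilin : E4 →L[ℝ] E4 →L[ℝ] ℝ)‖ ≤ 1 := Literature.Geometry.Lorentzian.Minkowski.norm_bilin_le_one
    calc ‖iteratedFDeriv ℝ m F₂ z‖ ≤ 8 * ‖(Minkowski.bilin : E4 →L[ℝ] E4 →L[ℝ] ℝ)‖ * ε := h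
      _ ≤ 8 * 1 * ε := by gcongr
      _ = 8 * ε := by ring
  have hks2 : ContDiffOn ℝ 2 (ksPert Λ c M a) {x : E4 | 0 < Kerr.radius a (poincareInv Λ c x)} :=
    contDiffOn_infty.1 (contDiffOn_ksPert Λ c M a) 2
  have hSz' : z + P z ∈ {x : E4 | 0 < Kerr.radius a (poincareInv Λ c x)} := radius_pos_of_mem_domain Λ c M a hSz
  have h3 : ‖iteratedFDeriv ℝ m F₃ z‖ ≤ 512 * N₃ :=
    norm_iteratedFDeriv_bilinPullback_id_add_le (isOpen_setOf_radius_pos Λ c a) hks2 hP3 hSz' hPb' hN₃ hN₃b hm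
  have h4 : ‖iteratedFDeriv ℝ m F₄ z‖ ≤ N₃ := hN₄b m hm
  calc ‖iteratedFDeriv ℝ m F₁ z + iteratedFDeriv ℝ m F₂ z + (iteratedFDeriv ℝ m F₃ z - iteratedFDeriv ℝ m F₄ z)‖
      ≤ ‖iteratedFDeriv ℝ m F₁ z‖ + ‖iteratedFDeriv ℝ m F₂ z‖ +
          (‖iteratedFDeriv ℝ m F₃ z‖ + ‖iteratedFDeriv ℝ m F₄ z‖) :=
        (norm_add_le _ _).trans (add_le_add (norm_add_le _ _) (norm_sub_le _ _))
    _ ≤ 512 * N₁ + 8 * ε + (512 * N₃ + N₃) := by gcongr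
    _ = 512 * N₁ + 8 * ε + 513 * N₃ := by ring

end Zone2

end Summit.FinalStateConjecture.FinalStateConjecture.Theorems.NeckGapDecay.ConnectionLevelCones.Glue
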